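import Summits.RiemannHypothesis.RiemannHypothesis.Theses.RuelleBand
import Literature.NumberTheory.LFunctions.ZetaUniversalityDiscMain
import Literature.Barriers.RiemannHypothesis.BohrDenseValues

/-!
# `RuelleBand.ZetaWeakRecurrence`, line `Sketch` — stub `stub_recurrence_of_approximant`
(crux stmt-RiemannHypothesis-18110, route `RuelleBand`)

The "approximable regime ⟹ recurrence" branch of the line's skeleton `ZetaWeakRecurrence_of`:
if on the closed disc `|s − z| ≤ r` of the half-strip `1/2 < σ < 1`
(`0 < r < min (Re z − 1/2, 1 − Re z)`) the function `ζ` is within `ε − η` (`η > 0`) of a function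
`g` holomorphic on a larger open disc `|s − z| < R` (`r < R`) and zero-free on the closed disc, then
beyond every height `T` some vertical shift `τ ≥ T` satisfies `max_{|s−z|≤r} |ζ(s+iτ) − ζ(s)| < ε`.

Proof: Voronin/Bagchi universality of `ζ` on discs (tree, PROVED:
`Literature.NumberTheory.LFunctions.Steuding2007_thm1_9_discAnalytic_holds`, Steuding Thm. 1.9)
applied to the TARGET `g` at level `η` (radii `ρ := r`, `R' := R`) gives a set of shifts `τ` of
positive lower density with `max_{|s−z|≤r} |ζ(s+iτ) − g(s)| < η`; such a set is unbounded above
(`Literature.Barriers.RiemannHypothesis.HasPosLowerDensity.exists_gt`), so one of them exceeds `T`;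
and the triangle inequality `|ζ(s+iτ) − ζ(s)| ≤ |ζ(s+iτ) − g(s)| + |g(s) − ζ(s)| < η + (ε − η) = ε`
concludes. (The case `g = ζ` on a zero-free disc is `weakRecurrence_of_zeroFree` of the
`ExactFirstBand` strategist sketch; here only the target changes and the triangle step is added.)

Main results:
* `hasPosLowerDensity_returnsToTarget` — Steuding Thm. 1.9 on discs repackaged as
  `HasPosLowerDensity` of the `η`-returns of `ζ(·+iτ)` to the target `g`;
* `recurrence_of_approximant` — curried form of the stub;
* `stub_recurrence_of_approximant` — the registered stub (uncurried `∀`-form, verbatim).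
-/

-- D-0017: single-problem summit; the lakefile turns this linter off for `Summits`; repeated here so that
-- standalone elaboration is warning-free as well.
set_option linter.dupNamespace false

noncomputable section

open Complex Set Metric Filter Topology MeasureTheory

namespace Summit.RiemannHypothesis.RiemannHypothesis.Theorems.RuelleBandZetaWeakRecurrence

open Summit.RiemannHypothesis.RiemannHypothesis.Theses.RuelleBand
open Literature.Barriers.RiemannHypothesis Literature.NumberTheory.LFunctions

/-- Voronin/Bagchi universality on discs, repackaged: for a closed disc `|s − z| ≤ r` of the
half-strip (`0 < r`, `1/2 < Re z − r`, `Re z + r < 1`), a target `g` holomorphic on `|s − z| < R`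
(`r < R`) and zero-free on the closed disc, and a level `η > 0`, the set of shifts `τ` with
`max_{|s−z|≤r} |ζ(s+iτ) − g(s)| < η` has positive lower density. [cite: Steuding2007, Thm. 1.9] -/
theorem hasPosLowerDensity_returnsToTarget {z : ℂ} {r R : ℝ} (hr : 0 < r) (hrR : r < R)
    (hr1 : 1 / 2 < z.re - r) (hr2 : z.re + r < 1) {g : ℂ → ℂ}
    (hg : DifferentiableOn ℂ g (ball z R)) (hg0 : ∀ s ∈ closedBall z r, g s ≠ 0) {η : ℝ}
    (hη : 0 < η) :
    HasPosLowerDensity {τ : ℝ | ∀ s ∈ closedBall z r, ‖riemannZeta (s + τ * I) - g s‖ < η} := by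
  obtain ⟨δ, hδ, T₀, hT₀⟩ :=
    Steuding2007_thm1_9_discAnalytic_holds z r R hr hrR hr1 hr2 g hg hg0 η hη
  exact ⟨δ, hδ, T₀, hT₀⟩

/-- **Approximable regime ⟹ recurrence** (curried form). If on the closed disc `|s − z| ≤ r` of
the half-strip (`0 < r < min (Re z − 1/2, 1 − Re z)`) `ζ` is within `ε − η` (`η > 0`) of a
function `g` holomorphic on a larger open disc `|s − z| < R` and zero-free on the closed disc,
then beyond every height `T` some shift `τ ≥ T` has `max_{|s−z|≤r} |ζ(s+iτ) − ζ(s)| < ε`: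
Steuding Thm. 1.9 for the target `g` at level `η`, a set of positive lower density is unbounded
above, and `|ζ(s+iτ) − ζ(s)| ≤ |ζ(s+iτ) − g(s)| + |g(s) − ζ(s)| < η + (ε − η) = ε`.
[cite: Steuding2007, Thm. 1.9] -/
theorem recurrence_of_approximant {z : ℂ} {r : ℝ} (hr : 0 < r)
    (hrmin : r < min (z.re - 1 / 2) (1 - z.re)) {ε R η : ℝ} {g : ℂ → ℂ} (hrR : r < R) (hη : 0 < η)
    (hg : DifferentiableOn ℂ g (ball z R)) (hg0 : ∀ s ∈ closedBall z r, g s ≠ 0)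
    (happrox : ∀ s ∈ closedBall z r, ‖riemannZeta s - g s‖ ≤ ε - η) (T : ℝ) :
    ∃ τ : ℝ, T ≤ τ ∧ ∀ s ∈ closedBall z r, ‖riemannZeta (s + τ * I) - riemannZeta s‖ < ε := by
  have hr1 : r < z.re - 1 / 2 := hrmin.trans_le (min_le_left _ _)
  have hr2 : r < 1 - z.re := hrmin.trans_le (min_le_right _ _)
  have hpos := hasPosLowerDensity_returnsToTarget hr hrR (by linarith) (by linarith) hg hg0 hη
  obtain ⟨τ, hτ, hTτ⟩ := hpos.exists_gt T
  refine ⟨τ, hTτ.le, fun s hs ↦ ?_⟩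
  calc ‖riemannZeta (s + τ * I) - riemannZeta s‖
      ≤ ‖riemannZeta (s + τ * I) - g s‖ + ‖g s - riemannZeta s‖ :=
        norm_sub_le_norm_sub_add_norm_sub _ _ _
    _ < η + (ε - η) := by
        refine add_lt_add_of_lt_of_le (hτ s hs) ?_
        rw [norm_sub_rev]
        exact happrox s hs
    _ = ε := by ring

/-- **Stub 1 of line `Sketch` (approximable regime ⟹ recurrence; registered form).**
If on the closed disc `|s − z| ≤ r` of the half-strip `ζ` is within `ε − η` (`η > 0`) of a function
`g` holomorphic on a larger open disc `|s − z| < R` and zero-free on the closed disc, then beyond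
every height `T` some shift `τ ≥ T` has `max_{|s−z|≤r} |ζ(s+iτ) − ζ(s)| < ε`.
(Steuding Thm. 1.9 for the target `g` at level `η`, then the triangle inequality; a set of positive
lower density is unbounded above. The hypothesis `0 < ε` is part of the registered signature and is
not needed: it follows from `0 < η ≤ ε − ‖ζ z − g z‖`.) [cite: Steuding2007, Thm. 1.9] -/
theorem stub_recurrence_of_approximant :
    ∀ (z : ℂ) (r : ℝ), 0 < r → r < min (z.re - 1 / 2) (1 - z.re) → ∀ ε : ℝ, 0 < ε →
      (∃ (R η : ℝ) (g : ℂ → ℂ), r < R ∧ 0 < η ∧ DifferentiableOn ℂ g (Metric.ball z R) ∧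
        (∀ s ∈ Metric.closedBall z r, g s ≠ 0) ∧
        ∀ s ∈ Metric.closedBall z r, ‖riemannZeta s - g s‖ ≤ ε - η) →
      ∀ T : ℝ, ∃ τ : ℝ, T ≤ τ ∧
        ∀ s ∈ Metric.closedBall z r, ‖riemannZeta (s + ↑τ * Complex.I) - riemannZeta s‖ < ε := by
  intro z r hr hrmin ε _ hA T
  obtain ⟨R, η, g, hrR, hη, hg, hg0, happrox⟩ := hA
  exact recurrence_of_approximant hr hrmin hrR hη hg hg0 happrox T

end Summit.RiemannHypothesis.RiemannHypothesis.Theorems.RuelleBandZetaWeakRecurrence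

end
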